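import Mathlib.LinearAlgebra.Matrix.NonsingularInverse
import Literature.NumberTheory.Automorphic.JacquetLanglandsTransfer
import Literature.NumberTheory.Automorphic.JacquetLanglandsLocalSatake
import Literature.NumberTheory.Automorphic.GLnCuspidalSpectrumFlathProofs
import Literature.NumberTheory.Automorphic.HeckeEigenvectorProjection
import HarnessLib

/-!
# Jacquet–Langlands: independence of the algebra splittings (Skolem–Noether)

Topic `NumberTheory/Automorphic`; proof-only file (no definition, no named fact).

The Satake-parameter form of the global Jacquet–Langlands correspondence vendored in
`Literature.NumberTheory.Automorphic.JacquetLanglands` / `JacquetLanglandsParts` measures the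
local data of an automorphic `πD ≤ L²(D_𝔸ˣ ⧸ ℝ_{>0} Dˣ)` at a split finite place `v` through an
*algebra* splitting `φ_v : D_v ≃ₐ[K_v] M₂(K_v)` (`unitsEquivOfSplitting`,
`HasSatakeParameterAtD`, `sphericalLevelAtD`; `HasLocalComponentAtD` of
`JacquetLanglandsLocalSatake`), and quantifies over **all** finite `S` and **all** families of
splittings `φ_v` (`v ∉ S`) at once. The module docstrings of both files justify this by the
Skolem–Noether theorem ("two algebra splittings differ by an inner automorphism
(Skolem–Noether), which does not change Satake parameters", `JacquetLanglands`; "Satake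
parameters through algebra splittings do not depend on the splitting, Skolem–Noether",
`JacquetLanglandsParts`), informally. This file **proves** that justification:

* `Matrix.exists_algEquiv_apply_eq_conj` — **Skolem–Noether for matrix algebras over a field**:
  every `F`-algebra automorphism `θ` of `M_n(F)` is inner, `θ(a) = g a g⁻¹` for some
  `g ∈ GL_n(F)` (elementary proof: `g e_i = θ(E_{i i₀}) m` for a non-zero `m` in the image of the
  rank-one idempotent `θ(E_{i₀ i₀})`); hence two `F`-algebra isomorphisms `A ≃ₐ[F] M_n(F)` differ
  by an inner automorphism (`Matrix.exists_algEquiv_apply_eq_conj_algEquiv_apply`), and two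
  splittings `θ, θ'` of `D` at `v` give conjugate identifications `D_vˣ ≃* GL₂(K_v)`
  (`exists_unitsEquivOfSplitting_eq_conj`);
* `exists_heckeEigenvector_comp_conj_iff` — Hecke eigen-systems (level `K₀`, elements `tᵢ`,
  eigenvalues `cᵢ`) of a representation `τ` of a group `L` and of its inner twist
  `τ ∘ Int(g)` correspond under `τ(g)` (Bump (1997), proof of Thm. 3.6.1: equivariant maps carry
  Hecke eigenvectors to Hecke eigenvectors);
* `hasLocalComponentAtD_iff_of_forall_eq_conj`, `hasSatakeParameterAtD_iff_of_forall_eq_conj` —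
  for conjugate identifications `e' = Int(g) ∘ e : D_vˣ ≃* GL_n(K_v)` the local components
  (`HasLocalComponentAtD`) and the Satake parameters at the transported spherical levels
  (`HasSatakeParameterAtD e W (sphericalLevelAtD v e)`) of any closed `W ≤ L²(D_𝔸ˣ ⧸ ℝ_{>0} Dˣ)`
  agree; in particular they do not depend on the choice of the algebra splitting
  (`hasLocalComponentAtD_unitsEquivOfSplitting_iff`,
  `hasSatakeParameterAtD_unitsEquivOfSplitting_iff`), and `HeckeCompatibleAway S φ πD Π` does
  not depend on `φ` (`heckeCompatibleAway_iff_of_splittings`) and follows, for every `S` and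
  `φ`, from the Satake matching through one fixed family of splittings at the split places
  (`heckeCompatibleAway_of_forall_not_mem_ramifiedPlaces`);
* `jacquetLanglands_transfer_exists_of_localComponents_splittings` — consequently the vendored
  existence half `jacquetLanglands_transfer_exists K D` of the correspondence (Gelbart (1975),
  Thm. 10.5 (i)) follows from Gelbart's Theorem 10.5 (i) (with the square-integrability clause of
  (ii)) stated, as printed, for **one fixed** system of identifications `D_v = M₂(K_v)` at the
  places `v ∉ Ram_f(D)` (Gelbart, p. 148: "`S` the set of places of `F` ramified in `D`"; the
  identifications outside `S` are fixed once and for all in §10) — sharpening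
  `jacquetLanglands_transfer_exists_of_localComponents` of `JacquetLanglandsTransferProofs`,
  whose hypothesis asked for the local matching through every splitting.

## References

* S. Gelbart, *Automorphic forms on adele groups*, Ann. of Math. Studies 83 (1975), §10,
  Thm. 10.5 (pp. 148–149) [Gelbart1975].
* H. Jacquet, R. P. Langlands, *Automorphic forms on GL(2)*, LNM 114 (1970), §14, Thm. 16.1
  [JacquetLanglands1970].
* N. Bourbaki, *Algèbre*, Ch. VIII (2012), §14 no 3, Thm. 3 (Skolem–Noether) [Bourbaki2012].
* M.-F. Vignéras, *Arithmétique des algèbres de quaternions*, LNM 800 (1980), Ch. I §2,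
  Thm. 2.1 (Skolem–Noether for quaternion algebras: "Les K-automorphismes de H sont des
  automorphismes intérieurs") [VignerasLNM800].
* D. Bump, *Automorphic forms and representations* (1997), Thm. 3.6.1 (proof, p. 342), §3.3
  [Bump1997].
-/

noncomputable section

open scoped TensorProduct MatrixGroups NNReal
open NumberField IsDedekindDomain MeasureTheory
open Literature.NumberTheory.Automorphic

universe u

/-! ### Skolem–Noether for matrix algebras over a field -/

namespace Matrix

section SkolemNoether

variable {F : Type*} [Field F] {ι : Type*} [Fintype ι] [DecidableEq ι]

/-- **Skolem–Noether for matrix algebras over a field**: every `F`-algebra automorphism `θ` of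
`M_n(F)` is inner, `θ(a) = g a g⁻¹` for some `g ∈ GL_n(F)`. Elementary proof: the images
`θ(E_{ij})` of the matrix units are matrix units of a conjugate frame; for a non-zero vector `m`
fixed by the idempotent `θ(E_{i₀i₀})` the matrix `g` with columns `g e_i = θ(E_{i i₀}) m`
satisfies `θ(a) g = g a` (check on matrix units) and is injective (`θ(E_{i₀ j}) g u = u_j m`)
(Bourbaki, *Algèbre* VIII, §14 no 3, Thm. 3 (Skolem–Noether), for simple algebras in general;
Vignéras (1980), Ch. I §2, Thm. 2.1: "Les K-automorphismes de H sont des automorphismes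
intérieurs" for quaternion algebras). [cite: Bourbaki2012, Ch. VIII §14 no 3 Thm. 3] -/
theorem exists_algEquiv_apply_eq_conj (θ : Matrix ι ι F ≃ₐ[F] Matrix ι ι F) :
    ∃ g : GL ι F, ∀ a : Matrix ι ι F,
      θ a = (g : Matrix ι ι F) * a * ((g⁻¹ : GL ι F) : Matrix ι ι F) := by
  classical
  rcases isEmpty_or_nonempty ι with hι | ⟨⟨i₀⟩⟩
  · exact ⟨1, fun a => Subsingleton.elim _ _⟩
  -- the idempotent `θ(E_{i₀ i₀})` is non-zero: pick a non-zero vector `m'` in its image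
  have hE0 : θ (single i₀ i₀ 1) ≠ 0 := by
    intro h0
    have h1 : single i₀ i₀ (1 : F) = 0 := θ.injective (h0.trans (map_zero θ).symm)
    have h2 := congrFun (congrFun h1 i₀) i₀
    simp only [single_apply_same, zero_apply, one_ne_zero] at h2
  obtain ⟨m, hm⟩ : ∃ m : ι → F, θ (single i₀ i₀ 1) *ᵥ m ≠ 0 := by
    by_contra hall
    refine hE0 (Matrix.ext fun p q => ?_)
    have h3 : θ (single i₀ i₀ 1) *ᵥ Pi.single q 1 = 0 := by
      by_contra h
      exact hall ⟨_, h⟩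
    have h2 := congrFun h3 p
    rwa [mulVec_single_one] at h2
  set m' : ι → F := θ (single i₀ i₀ 1) *ᵥ m with hm'def
  have hidem : θ (single i₀ i₀ 1) *ᵥ m' = m' := by
    rw [hm'def, mulVec_mulVec, ← map_mul, single_mul_single_same, mul_one]
  -- the candidate conjugator, by columns: `g e_i = θ(E_{i i₀}) m'`
  let g : Matrix ι ι F := of fun p i => (θ (single i i₀ 1) *ᵥ m') p
  have hgcol : ∀ i, g *ᵥ Pi.single i 1 = θ (single i i₀ 1) *ᵥ m' := by
    intro i
    rw [mulVec_single_one]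
    rfl
  -- `θ(a) g = g a`, first on matrix units
  have hunit : ∀ (j k : ι) (c : F), θ (single j k c) * g = g * single j k c := by
    intro j k c
    ext p i
    have hl : (θ (single j k c) * g) p i = (θ (single j k c * single i i₀ 1) *ᵥ m') p := by
      rw [map_mul, ← mulVec_mulVec, mul_apply']
      rfl
    rw [hl]
    by_cases hki : k = i
    · subst hki
      rw [single_mul_single_same, mul_one, mul_single_apply_same]
      have hs : single j i₀ c = c • single j i₀ (1 : F) := by
        rw [smul_single, smul_eq_mul, mul_one]
      rw [hs, map_smul, smul_mulVec, Pi.smul_apply, smul_eq_mul, mul_comm]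
      rfl
    · rw [single_mul_single_of_ne (h := hki), map_zero, zero_mulVec, Pi.zero_apply,
        mul_single_apply_of_ne (hbj := Ne.symm hki)]
  have hcomm : ∀ a, θ a * g = g * a := by
    intro a
    conv_lhs => rw [matrix_eq_sum_single a]
    conv_rhs => rw [matrix_eq_sum_single a]
    rw [map_sum, Finset.sum_mul, Finset.mul_sum]
    refine Finset.sum_congr rfl fun j _ => ?_
    rw [map_sum, Finset.sum_mul, Finset.mul_sum]
    exact Finset.sum_congr rfl fun k _ => hunit j k (a j k)
  -- `g` is injective, hence invertible
  have hker : ∀ u : ι → F, g *ᵥ u = 0 → u = 0 := by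
    intro u hu
    funext j
    have h1 : θ (single i₀ j 1) *ᵥ (g *ᵥ u) = u j • m' := by
      rw [mulVec_mulVec, hcomm, ← mulVec_mulVec, single_mulVec_eq, one_mul, mulVec_smul, hgcol,
        hidem]
    rw [hu, mulVec_zero] at h1
    by_contra hj
    exact hm ((smul_eq_zero.1 h1.symm).resolve_left hj)
  have hinj : Function.Injective g.mulVec := by
    intro u w huw
    rw [← sub_eq_zero]
    refine hker _ ?_
    rw [mulVec_sub, huw, sub_self]
  obtain ⟨gu, hgu⟩ := mulVec_injective_iff_isUnit.1 hinj
  refine ⟨gu, fun a => ?_⟩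
  have h := hcomm a
  rw [← hgu] at h
  calc θ a = θ a * ((gu : Matrix ι ι F) * ((gu⁻¹ : GL ι F) : Matrix ι ι F)) := by
        rw [Units.mul_inv, mul_one]
    _ = (gu : Matrix ι ι F) * a * ((gu⁻¹ : GL ι F) : Matrix ι ι F) := by rw [← mul_assoc, h]

/-- **Two `F`-algebra isomorphisms onto a matrix algebra differ by an inner automorphism**
(Skolem–Noether for `M_n(F)`): for `θ, θ' : A ≃ₐ[F] M_n(F)` there is `g ∈ GL_n(F)` with
`θ'(a) = g θ(a) g⁻¹` for all `a ∈ A` (`exists_algEquiv_apply_eq_conj` for `θ' ∘ θ⁻¹`;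
Bourbaki, *Algèbre* VIII, §14 no 3, Thm. 3; Vignéras (1980), Ch. I §2, Thm. 2.1).
[cite: Bourbaki2012, Ch. VIII §14 no 3 Thm. 3] -/
theorem exists_algEquiv_apply_eq_conj_algEquiv_apply {A : Type*} [Ring A] [Algebra F A]
    (θ θ' : A ≃ₐ[F] Matrix ι ι F) :
    ∃ g : GL ι F, ∀ a : A,
      θ' a = (g : Matrix ι ι F) * θ a * ((g⁻¹ : GL ι F) : Matrix ι ι F) := by
  obtain ⟨g, hg⟩ := exists_algEquiv_apply_eq_conj (θ.symm.trans θ')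
  refine ⟨g, fun a => ?_⟩
  have := hg (θ a)
  rwa [AlgEquiv.trans_apply, AlgEquiv.symm_apply_apply] at this

end SkolemNoether

end Matrix

namespace Literature.NumberTheory.Automorphic

/-! ### Hecke eigen-systems and fixed vectors under inner twists -/

section ConjRep

variable {k L V : Type*} [CommRing k] [Group L] [AddCommGroup V] [Module k V]

/-- Fixed vectors of `ρ` under an image subgroup `f(K₀)` are the fixed vectors of the restricted
representation `ρ ∘ f` under `K₀` (unfolding). [folklore] -/
theorem mem_fixedPoints_map_iff {G₀ : Type*} [Group G₀] (f : G₀ →* L) (ρ : Representation k L V)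
    (K₀ : Subgroup G₀) (x : V) :
    x ∈ ρ.fixedPoints (K₀.map f) ↔ x ∈ Representation.fixedPoints (ρ.comp f) K₀ := by
  rw [Representation.mem_fixedPoints, Representation.mem_fixedPoints]
  constructor
  · intro h y hy
    exact h (f y) ⟨y, hy, rfl⟩
  · rintro h _ ⟨y, hy, rfl⟩
    exact h y hy

/-- **Hecke eigen-systems are invariant under inner twists.** For a representation `τ` of a
group `L`, `g ∈ L`, a level `K₀ ≤ L`, elements `tᵢ ∈ L` and scalars `cᵢ`: the inner twist
`τ ∘ Int(g)` (`Int(g) x = g x g⁻¹`) has a non-zero `K₀`-fixed vector `f` with `[K₀ tᵢ K₀] f = cᵢ f`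
for the prescribed `i` iff `τ` has one — `τ(g)` is an equivariant bijection `τ → τ ∘ Int(g)`, and
equivariant maps carry `K₀`-fixed Hecke eigenvectors to `K₀`-fixed Hecke eigenvectors with the
same eigenvalues (`map_heckeOperator_apply`, `map_mem_fixedPoints_of_comm`; Bump (1997), proof of
Thm. 3.6.1, p. 342). [cite: Bump1997, Thm. 3.6.1 (proof, p. 342)] -/
theorem exists_heckeEigenvector_comp_conj_iff (τ : Representation k L V) (g : L)
    (K₀ : Subgroup L) {ι' : Sort*} (p : ι' → Prop) (t : ι' → L) (c : ι' → k) :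
    (∃ f ∈ Representation.fixedPoints (τ.comp (MulAut.conj g).toMonoidHom) K₀, f ≠ 0 ∧
        ∀ i, p i → heckeOperator (τ.comp (MulAut.conj g).toMonoidHom) K₀ (t i) f = c i • f) ↔
      (∃ f ∈ τ.fixedPoints K₀, f ≠ 0 ∧ ∀ i, p i → heckeOperator τ K₀ (t i) f = c i • f) := by
  set τ' : Representation k L V := τ.comp (MulAut.conj g).toMonoidHom with hτ'
  have hτ'app : ∀ x : L, τ' x = τ (g * x * g⁻¹) := fun x => rfl
  have hL : ∀ (x : L) (w : V), τ g (τ x w) = τ' x (τ g w) := fun x w => by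
    rw [hτ'app, ← Module.End.mul_apply, ← map_mul, ← Module.End.mul_apply, ← map_mul,
      inv_mul_cancel_right]
  have hL' : ∀ (x : L) (w : V), τ g⁻¹ (τ' x w) = τ x (τ g⁻¹ w) := fun x w => by
    rw [hτ'app, ← Module.End.mul_apply, ← map_mul, ← Module.End.mul_apply, ← map_mul,
      mul_assoc g x, inv_mul_cancel_left]
  have hgg : ∀ w : V, τ g (τ g⁻¹ w) = w := fun w => by
    rw [← Module.End.mul_apply, ← map_mul, mul_inv_cancel, map_one, Module.End.one_apply]
  have hgg' : ∀ w : V, τ g⁻¹ (τ g w) = w := fun w => by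
    rw [← Module.End.mul_apply, ← map_mul, inv_mul_cancel, map_one, Module.End.one_apply]
  constructor
  · rintro ⟨f, hf, hf0, heig⟩
    refine ⟨τ g⁻¹ f, map_mem_fixedPoints_of_comm τ' τ K₀ (τ g⁻¹) hL' hf, fun h0 => hf0 ?_,
      fun i hi => ?_⟩
    · rw [← hgg f, h0, map_zero]
    · rw [← map_heckeOperator_apply τ' τ K₀ (τ g⁻¹) hL', heig i hi, map_smul]
  · rintro ⟨f, hf, hf0, heig⟩
    refine ⟨τ g f, map_mem_fixedPoints_of_comm τ τ' K₀ (τ g) hL hf, fun h0 => hf0 ?_,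
      fun i hi => ?_⟩
    · rw [← hgg' f, h0, map_zero]
    · rw [← map_heckeOperator_apply τ τ' K₀ (τ g) hL, heig i hi, map_smul]

end ConjRep

/-! ### Conjugate identifications `D_vˣ ≃* GL_n(K_v)` -/

section ConjIdent

variable {K : Type} [Field K] [NumberField K] {D : Type u} [Ring D] [Algebra K D]
  {n : ℕ} {v : HeightOneSpectrum (𝓞 K)}

/-- If `e' = Int(g) ∘ e`, then `e'⁻¹ x = e⁻¹ (g⁻¹ x g)`. [folklore] -/
theorem mulEquiv_symm_apply_of_forall_eq_conj
    {e e' : completionUnits D v ≃* GL (Fin n) (v.adicCompletion K)}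
    {g : GL (Fin n) (v.adicCompletion K)} (he : ∀ y, e' y = g * e y * g⁻¹)
    (x : GL (Fin n) (v.adicCompletion K)) : e'.symm x = e.symm (g⁻¹ * x * g) := by
  apply e'.injective
  rw [MulEquiv.apply_symm_apply, he, MulEquiv.apply_symm_apply, ← mul_assoc, ← mul_assoc,
    mul_inv_cancel, one_mul, mul_assoc, mul_inv_cancel, mul_one]

/-- **Two algebra splittings of `D` at `v` give conjugate identifications `D_vˣ ≃* GL₂(K_v)`**
(Skolem–Noether, `Matrix.exists_algEquiv_apply_eq_conj_algEquiv_apply`): for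
`θ, θ' : D_v ≃ₐ[K_v] M₂(K_v)` there is `g ∈ GL₂(K_v)` with
`unitsEquivOfSplitting θ' y = g (unitsEquivOfSplitting θ y) g⁻¹` for all `y ∈ D_vˣ`
(Vignéras (1980), Ch. I §2, Thm. 2.1). [cite: VignerasLNM800, Ch. I §2 Thm. 2.1] -/
theorem exists_unitsEquivOfSplitting_eq_conj
    (θ θ' : ScalarExtension K (v.adicCompletion K) D ≃ₐ[v.adicCompletion K]
      Matrix (Fin 2) (Fin 2) (v.adicCompletion K)) :
    ∃ g : GL (Fin 2) (v.adicCompletion K), ∀ y : completionUnits D v,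
      unitsEquivOfSplitting θ' y = g * unitsEquivOfSplitting θ y * g⁻¹ := by
  obtain ⟨g, hg⟩ := Matrix.exists_algEquiv_apply_eq_conj_algEquiv_apply θ θ'
  refine ⟨g, fun y => Units.ext ?_⟩
  rw [Units.val_mul, Units.val_mul]
  exact hg (y : ScalarExtension K (v.adicCompletion K) D)

end ConjIdent

/-! ### Local components through conjugate identifications -/

section LocalComponent

variable {K : Type} [Field K] [NumberField K] {D : Type u} [Ring D] [Algebra K D]
  [Module.Finite K D]
  {μ_D : Measure (AdelicGroupData.units K D).automorphicQuotient}
  [SMulInvariantMeasure (AdelicGroupData.units K D).Adelic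
    (AdelicGroupData.units K D).automorphicQuotient μ_D]
  {n : ℕ} {v : HeightOneSpectrum (𝓞 K)}

/-- **Local components through conjugate identifications, one direction.** If `e' = Int(g) ∘ e`
and `W` has local component `ρ` at `v` through `e` (intertwiner `f`), then it has local component
`ρ` through `e'`: the intertwiner is `f ∘ ρ(g⁻¹)`. [folklore] -/
theorem HasLocalComponentAtD.of_forall_eq_conj
    {e e' : completionUnits D v ≃* GL (Fin n) (v.adicCompletion K)}
    {g : GL (Fin n) (v.adicCompletion K)} (he : ∀ y, e' y = g * e y * g⁻¹)
    {W : ContRepresentation.ClosedSubrep ((AdelicGroupData.units K D).rightRegular μ_D)}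
    {V : Type*} [AddCommGroup V] [Module ℂ V]
    {ρ : Representation ℂ (GL (Fin n) (v.adicCompletion K)) V}
    (h : HasLocalComponentAtD e W ρ) : HasLocalComponentAtD e' W ρ := by
  obtain ⟨f, hf0, hf⟩ := h
  refine ⟨f ∘ₗ ρ g⁻¹, fun h0 => hf0 ?_, fun x w => ?_⟩
  · refine LinearMap.ext fun w => ?_
    have h1 : (f ∘ₗ ρ g⁻¹) (ρ g w) = 0 := by rw [h0, LinearMap.zero_apply]
    rwa [LinearMap.comp_apply, ← Module.End.mul_apply, ← map_mul, inv_mul_cancel, map_one,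
      Module.End.one_apply] at h1
  · have h1 : (f ∘ₗ ρ g⁻¹) (ρ x w) = f (ρ (g⁻¹ * x) w) := by
      rw [LinearMap.comp_apply, map_mul, Module.End.mul_apply]
    have h2 : W.toContRep (Quat.ofLocal K D v (e'.symm x)) ((f ∘ₗ ρ g⁻¹) w) =
        f (ρ (g⁻¹ * x * g) (ρ g⁻¹ w)) := by
      rw [LinearMap.comp_apply, mulEquiv_symm_apply_of_forall_eq_conj he, hf (g⁻¹ * x * g) (ρ g⁻¹ w)]
    rw [h1, h2, ← Module.End.mul_apply, ← map_mul, mul_inv_cancel_right]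

/-- **Local components do not depend on the identification up to conjugacy**: for
`e' = Int(g) ∘ e`, `HasLocalComponentAtD e W ρ ↔ HasLocalComponentAtD e' W ρ`. [folklore] -/
theorem hasLocalComponentAtD_iff_of_forall_eq_conj
    {e e' : completionUnits D v ≃* GL (Fin n) (v.adicCompletion K)}
    {g : GL (Fin n) (v.adicCompletion K)} (he : ∀ y, e' y = g * e y * g⁻¹)
    (W : ContRepresentation.ClosedSubrep ((AdelicGroupData.units K D).rightRegular μ_D))
    {V : Type*} [AddCommGroup V] [Module ℂ V]
    (ρ : Representation ℂ (GL (Fin n) (v.adicCompletion K)) V) :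
    HasLocalComponentAtD e W ρ ↔ HasLocalComponentAtD e' W ρ := by
  refine ⟨HasLocalComponentAtD.of_forall_eq_conj he, HasLocalComponentAtD.of_forall_eq_conj
    (g := g⁻¹) fun y => ?_⟩
  rw [he, inv_inv, ← mul_assoc, ← mul_assoc, inv_mul_cancel, one_mul, mul_assoc,
    inv_mul_cancel, mul_one]

/-- **Local components of `πD` at a split place do not depend on the algebra splitting**: for
two splittings `θ, θ' : D_v ≃ₐ[K_v] M₂(K_v)` and every representation `ρ` of `GL₂(K_v)`,
`HasLocalComponentAtD (unitsEquivOfSplitting θ) W ρ ↔ HasLocalComponentAtD (unitsEquivOfSplitting θ') W ρ`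
(Skolem–Noether: the two identifications are conjugate, `exists_unitsEquivOfSplitting_eq_conj`).
[cite: VignerasLNM800, Ch. I §2 Thm. 2.1] -/
theorem hasLocalComponentAtD_unitsEquivOfSplitting_iff
    (θ θ' : ScalarExtension K (v.adicCompletion K) D ≃ₐ[v.adicCompletion K]
      Matrix (Fin 2) (Fin 2) (v.adicCompletion K))
    (W : ContRepresentation.ClosedSubrep ((AdelicGroupData.units K D).rightRegular μ_D))
    {V : Type*} [AddCommGroup V] [Module ℂ V]
    (ρ : Representation ℂ (GL (Fin 2) (v.adicCompletion K)) V) :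
    HasLocalComponentAtD (unitsEquivOfSplitting θ) W ρ ↔
      HasLocalComponentAtD (unitsEquivOfSplitting θ') W ρ := by
  obtain ⟨g, hg⟩ := exists_unitsEquivOfSplitting_eq_conj θ θ'
  exact hasLocalComponentAtD_iff_of_forall_eq_conj hg W ρ

end LocalComponent

/-! ### Satake parameters through conjugate identifications -/

section Satake

variable {K : Type} [Field K] [NumberField K] {D : Type u} [Ring D] [Algebra K D]
  [Module.Finite K D]
  {μ_D : Measure (AdelicGroupData.units K D).automorphicQuotient}
  [SMulInvariantMeasure (AdelicGroupData.units K D).Adelic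
    (AdelicGroupData.units K D).automorphicQuotient μ_D]
  {n : ℕ} {v : HeightOneSpectrum (𝓞 K)}

/-- **Satake parameters of `D^×` at a split place, read on the restricted representation.**
`W` has Satake parameter `α` at `v` through `e` at the transported spherical level
`K'_v = ι_e(GL_n(𝒪_v))` (`ι_e = Quat.ofLocal ∘ e⁻¹`, here any homomorphism `ιe` agreeing with it
pointwise) iff the restricted representation `W ∘ ι_e` of `GL_n(K_v)` has a non-zero
`GL_n(𝒪_v)`-fixed vector on which the local Hecke operators
`[GL_n(𝒪_v) diag(ϖ,…,ϖ,1,…,1) GL_n(𝒪_v)]` act by `q_v^{i(n-i)/2} eᵢ(α)` (Hecke operators along the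
injective `ι_e`, `heckeOperator_map_apply_eq`; Bump (1997), §3.3). [folklore] -/
theorem hasSatakeParameterAtD_sphericalLevelAtD_iff
    (e : completionUnits D v ≃* GL (Fin n) (v.adicCompletion K))
    (W : ContRepresentation.ClosedSubrep ((AdelicGroupData.units K D).rightRegular μ_D))
    (ιe : GL (Fin n) (v.adicCompletion K) →* (AdelicGroupData.units K D).Adelic)
    (hι : ∀ x, ιe x = Quat.ofLocal K D v (e.symm x))
    (ϖ : (v.adicCompletion K)ˣ) (α : Multiset ℂ) :
    HasSatakeParameterAtD e W (sphericalLevelAtD v e) ϖ α ↔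
      Valued.v (ϖ : v.adicCompletion K) = WithZero.exp (-1 : ℤ) ∧ Multiset.card α = n ∧
        ∃ f ∈ Representation.fixedPoints (W.toContRep.toRepresentation.comp ιe)
            (valuedCongruenceSubgroup (Fin n) (1 : WithZero (Multiplicative ℤ))),
          f ≠ 0 ∧ ∀ i ≤ n,
            heckeOperator (W.toContRep.toRepresentation.comp ιe)
                (valuedCongruenceSubgroup (Fin n) (1 : WithZero (Multiplicative ℤ)))
                (heckeDiag n ϖ i) f =
              (((Real.sqrt (v.residueCard : ℝ) : ℝ) : ℂ) ^ (i * (n - i)) * α.esymm i) • f := by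
  set K₀ : Subgroup (GL (Fin n) (v.adicCompletion K)) :=
    valuedCongruenceSubgroup (Fin n) (1 : WithZero (Multiplicative ℤ)) with hK₀
  set σ : Representation ℂ (AdelicGroupData.units K D).Adelic W.toSubmodule :=
    W.toContRep.toRepresentation with hσ
  have hιeq : ιe = (Quat.ofLocal K D v).comp e.symm.toMonoidHom := MonoidHom.ext hι
  have hinj : Function.Injective ιe := by
    rw [hιeq]
    exact Quat.ofLocal_comp_symm_injective v e
  have hK : sphericalLevelAtD v e = K₀.map ιe := by
    rw [hιeq]
    exact sphericalLevelAtD_eq_map_comp v e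
  have hfix : ∀ f : W.toSubmodule,
      f ∈ W.fixedVectors (sphericalLevelAtD v e) ↔ f ∈ Representation.fixedPoints (σ.comp ιe) K₀ := by
    intro f
    rw [hK]
    exact mem_fixedPoints_map_iff ιe σ K₀ f
  have hop : ∀ f : W.toSubmodule, f ∈ W.fixedVectors (sphericalLevelAtD v e) → ∀ i,
      heckeOperatorAt W (sphericalLevelAtD v e) (heckeDiagAtD v e ϖ i) f =
        heckeOperator (σ.comp ιe) K₀ (heckeDiag n ϖ i) f := by
    intro f hf i
    have hf' : f ∈ σ.fixedPoints (K₀.map ιe) := by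
      rw [← hK]
      exact hf
    have hd : heckeDiagAtD v e ϖ i = ιe (heckeDiag n ϖ i) := (hι _).symm
    rw [heckeOperatorAt, hd, hK]
    exact heckeOperator_map_apply_eq ιe hinj K₀ σ (heckeDiag n ϖ i)
      (finite_orbit_valuedCongruenceSubgroup_one n K v _) hf'
  constructor
  · rintro ⟨hϖ, hcard, f, hf, hf0, hT⟩
    refine ⟨hϖ, hcard, f, (hfix f).1 hf, hf0, fun i hi => ?_⟩
    rw [← hop f hf i]
    exact hT i hi
  · rintro ⟨hϖ, hcard, f, hf, hf0, hT⟩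
    have hf' : f ∈ W.fixedVectors (sphericalLevelAtD v e) := (hfix f).2 hf
    refine ⟨hϖ, hcard, f, hf', hf0, fun i hi => ?_⟩
    rw [hop f hf' i]
    exact hT i hi

/-- **Satake parameters through conjugate identifications agree**: for `e' = Int(g) ∘ e`,
`W` has Satake parameter `α` at `v` through `e` (level `ι_e(GL_n(𝒪_v))`) iff it does through `e'`
(level `ι_{e'}(GL_n(𝒪_v))`). The restricted representations satisfy `W ∘ ι_{e'} = (W ∘ ι_e) ∘ Int(g⁻¹)`
(`mulEquiv_symm_apply_of_forall_eq_conj`), and Hecke eigen-systems are invariant under inner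
twists (`exists_heckeEigenvector_comp_conj_iff`: translate the eigenvector by `W(ι_e(g⁻¹))`;
Bump (1997), proof of Thm. 3.6.1). [folklore] -/
theorem hasSatakeParameterAtD_iff_of_forall_eq_conj
    {e e' : completionUnits D v ≃* GL (Fin n) (v.adicCompletion K)}
    {g : GL (Fin n) (v.adicCompletion K)} (he : ∀ y, e' y = g * e y * g⁻¹)
    (W : ContRepresentation.ClosedSubrep ((AdelicGroupData.units K D).rightRegular μ_D))
    (ϖ : (v.adicCompletion K)ˣ) (α : Multiset ℂ) :
    HasSatakeParameterAtD e W (sphericalLevelAtD v e) ϖ α ↔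
      HasSatakeParameterAtD e' W (sphericalLevelAtD v e') ϖ α := by
  let ιe : GL (Fin n) (v.adicCompletion K) →* (AdelicGroupData.units K D).Adelic :=
    (Quat.ofLocal K D v).comp e.symm.toMonoidHom
  have hι : ∀ x, ιe x = Quat.ofLocal K D v (e.symm x) := fun x => rfl
  let ιe' : GL (Fin n) (v.adicCompletion K) →* (AdelicGroupData.units K D).Adelic :=
    ιe.comp (MulAut.conj g⁻¹).toMonoidHom
  have hι' : ∀ x, ιe' x = Quat.ofLocal K D v (e'.symm x) := fun x => by
    change Quat.ofLocal K D v (e.symm (g⁻¹ * x * g⁻¹⁻¹)) = Quat.ofLocal K D v (e'.symm x)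
    rw [mulEquiv_symm_apply_of_forall_eq_conj he, inv_inv]
  rw [hasSatakeParameterAtD_sphericalLevelAtD_iff e W ιe hι ϖ α,
    hasSatakeParameterAtD_sphericalLevelAtD_iff e' W ιe' hι' ϖ α]
  exact and_congr_right fun _ => and_congr_right fun _ =>
    (exists_heckeEigenvector_comp_conj_iff (W.toContRep.toRepresentation.comp ιe) g⁻¹
      (valuedCongruenceSubgroup (Fin n) (1 : WithZero (Multiplicative ℤ))) (fun i => i ≤ n)
      (fun i => heckeDiag n ϖ i)
      (fun i => ((Real.sqrt (v.residueCard : ℝ) : ℝ) : ℂ) ^ (i * (n - i)) * α.esymm i)).symm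

/-- **Satake parameters of `πD` at a split place do not depend on the algebra splitting**
(the remark "two algebra splittings differ by an inner automorphism (Skolem–Noether), which does
not change Satake parameters" of `JacquetLanglands`, now a theorem): for two splittings
`θ, θ' : D_v ≃ₐ[K_v] M₂(K_v)`, `HasSatakeParameterAtD` through `θ` at `sphericalLevelAtD v θ`
iff through `θ'` at `sphericalLevelAtD v θ'`. [cite: VignerasLNM800, Ch. I §2 Thm. 2.1] -/
theorem hasSatakeParameterAtD_unitsEquivOfSplitting_iff
    (θ θ' : ScalarExtension K (v.adicCompletion K) D ≃ₐ[v.adicCompletion K]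
      Matrix (Fin 2) (Fin 2) (v.adicCompletion K))
    (W : ContRepresentation.ClosedSubrep ((AdelicGroupData.units K D).rightRegular μ_D))
    (ϖ : (v.adicCompletion K)ˣ) (α : Multiset ℂ) :
    HasSatakeParameterAtD (unitsEquivOfSplitting θ) W
        (sphericalLevelAtD v (unitsEquivOfSplitting θ)) ϖ α ↔
      HasSatakeParameterAtD (unitsEquivOfSplitting θ') W
        (sphericalLevelAtD v (unitsEquivOfSplitting θ')) ϖ α := by
  obtain ⟨g, hg⟩ := exists_unitsEquivOfSplitting_eq_conj θ θ'
  exact hasSatakeParameterAtD_iff_of_forall_eq_conj hg W ϖ α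

end Satake

/-! ### Hecke compatibility away from `S` does not depend on the splittings -/

section Compatible

variable {K : Type} [Field K] [NumberField K] {D : Type u} [Ring D] [Algebra K D]
  [Module.Finite K D]
  {μ_D : Measure (AdelicGroupData.units K D).automorphicQuotient}
  [SMulInvariantMeasure (AdelicGroupData.units K D).Adelic
    (AdelicGroupData.units K D).automorphicQuotient μ_D]
  {μ : Measure (AdelicGroupData.gl 2 K).automorphicQuotient}
  [SMulInvariantMeasure (AdelicGroupData.gl 2 K).Adelic
    (AdelicGroupData.gl 2 K).automorphicQuotient μ]

/-- **`HeckeCompatibleAway S φ πD Π` does not depend on the family of splittings `φ`**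
(Skolem–Noether, `hasSatakeParameterAtD_unitsEquivOfSplitting_iff` at each `v ∉ S`).
[cite: VignerasLNM800, Ch. I §2 Thm. 2.1] -/
theorem heckeCompatibleAway_iff_of_splittings (S : Finset (HeightOneSpectrum (𝓞 K)))
    (φ φ' : ∀ v, v ∉ S → (ScalarExtension K (v.adicCompletion K) D ≃ₐ[v.adicCompletion K]
      Matrix (Fin 2) (Fin 2) (v.adicCompletion K)))
    (πD : DiscreteAutomorphicRep (AdelicGroupData.units K D) μ_D)
    (π : CuspidalAutomorphicRepGL 2 K μ) :
    HeckeCompatibleAway S φ πD π ↔ HeckeCompatibleAway S φ' πD π := by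
  refine forall_congr' fun v => forall_congr' fun hv => forall_congr' fun ϖ =>
    forall_congr' fun α => ?_
  rw [hasSatakeParameterAtD_unitsEquivOfSplitting_iff (φ v hv) (φ' v hv) πD.space ϖ α]

/-- **Hecke compatibility away from every `S`, through all splittings, from the Satake matching
through one fixed family of splittings at the split places.** If `θ₀_v : D_v ≃ₐ[K_v] M₂(K_v)`
(`v ∉ Ram_f(D)`) is a fixed family of splittings and `Π`, `πD` have the same Satake parameters at
every `v ∉ Ram_f(D)` through `θ₀_v`, then `HeckeCompatibleAway S φ πD Π` for every finite `S` and
every family `φ` on the complement of `S` (a splitting `φ_v` at `v ∉ S` forces `v ∉ Ram_f(D)`,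
and the Satake condition through `φ_v` is the one through `θ₀_v`,
`hasSatakeParameterAtD_unitsEquivOfSplitting_iff`). [folklore] -/
theorem heckeCompatibleAway_of_forall_not_mem_ramifiedPlaces
    (θ₀ : ∀ v, v ∉ ramifiedPlaces K D →
      (ScalarExtension K (v.adicCompletion K) D ≃ₐ[v.adicCompletion K]
        Matrix (Fin 2) (Fin 2) (v.adicCompletion K)))
    (πD : DiscreteAutomorphicRep (AdelicGroupData.units K D) μ_D)
    (π : CuspidalAutomorphicRepGL 2 K μ)
    (h : ∀ (v : HeightOneSpectrum (𝓞 K)) (hv : v ∉ ramifiedPlaces K D) (ϖ : (v.adicCompletion K)ˣ)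
      (α : Multiset ℂ),
      HasSatakeParameterAt π.1 (sphericalLevelAt K 2 v) v ϖ α ↔
        HasSatakeParameterAtD (unitsEquivOfSplitting (θ₀ v hv)) πD.space
          (sphericalLevelAtD v (unitsEquivOfSplitting (θ₀ v hv))) ϖ α)
    (S : Finset (HeightOneSpectrum (𝓞 K)))
    (φ : ∀ v, v ∉ S → (ScalarExtension K (v.adicCompletion K) D ≃ₐ[v.adicCompletion K]
      Matrix (Fin 2) (Fin 2) (v.adicCompletion K))) :
    HeckeCompatibleAway S φ πD π := by
  intro v hv ϖ α
  have hv' : v ∉ ramifiedPlaces K D := fun hr => hr ⟨φ v hv⟩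
  rw [h v hv' ϖ α,
    hasSatakeParameterAtD_unitsEquivOfSplitting_iff (θ₀ v hv') (φ v hv) πD.space ϖ α]

end Compatible

/-! ### Consequence for the existence of the transfer -/

section Assembly

variable (K : Type) [Field K] [NumberField K] (D : Type u) [Ring D] [Algebra K D]
  [IsQuaternionAlgebra K D]

/-- **`jacquetLanglands_transfer_exists` from Gelbart's Theorem 10.5 (i) for one fixed system of
identifications at the split places.** Fix splittings `θ₀_v : D_v ≃ₐ[K_v] M₂(K_v)` at the places
`v ∉ Ram_f(D)` (Gelbart (1975), §10, p. 148: "`S` the set of places of `F` ramified in `D`", the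
identifications `D_v = M₂(F_v)`, `v ∉ S`, being fixed). Suppose (`hA₀`): for `D` a division
quaternion algebra and every automorphic `πD ≤ L²(D_𝔸ˣ ⧸ ℝ_{>0} Dˣ)` of dimension `> 1` there
is a cuspidal `Π` of `GL₂(𝔸_K)` which (i₀) at every `v ∉ Ram_f(D)` has, through `θ₀_v`, the same
irreducible smooth local components as `πD` ("the representation of `GL(2, 𝔸)` whose `v`-th
component is equivalent to `π'_v` if `v ∉ S` … is a cusp form", Thm. 10.5 (i)) and (ii) at every
`v ∈ Ram_f(D)` has an irreducible admissible local component which is square-integrable modulo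
the centre ("such that `π_v` is square-integrable for each `v ∈ S`", p. 149; Thm. 7.6 (ii)). Then
`jacquetLanglands_transfer_exists K D`: by Skolem–Noether the local matching through `θ₀_v`
is the local matching through any splitting `φ_v` (`hasLocalComponentAtD_unitsEquivOfSplitting_iff`),
hence the Satake matching `HeckeCompatibleAway S φ πD Π` for all `S`, `φ`
(`heckeCompatibleAway_of_localComponents`), i.e. the printed transfer theorem in Satake form
(the explicit hypothesis `hT` of `jacquetLanglands_transfer_exists_of_Gelbart1975`), which with
Flath's uniqueness of local components (`nonempty_equiv_of_hasLocalComponentAt_holds`) gives the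
vendored fact (`jacquetLanglands_transfer_exists_of_Gelbart1975`); cf. the sibling
`jacquetLanglands_transfer_exists_of_localComponents` of `JacquetLanglandsTransferProofs`, whose
hypothesis asks for the local matching through every splitting.
[cite: Gelbart1975, Thm. 10.5 (i)–(ii), pp. 148–149] -/
theorem jacquetLanglands_transfer_exists_of_localComponents_splittings
    (θ₀ : ∀ v, v ∉ ramifiedPlaces K D →
      (ScalarExtension K (v.adicCompletion K) D ≃ₐ[v.adicCompletion K]
        Matrix (Fin 2) (Fin 2) (v.adicCompletion K)))
    (hA₀ : ∀ (_hdiv : ∀ x : D, x ≠ 0 → IsUnit x)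
      (μ_D : Measure (AdelicGroupData.units K D).automorphicQuotient)
      [(AdelicGroupData.units K D).IsAutomorphicMeasure μ_D]
      (μ : Measure (AdelicGroupData.gl 2 K).automorphicQuotient)
      [(AdelicGroupData.gl 2 K).IsAutomorphicMeasure μ]
      [∀ v : HeightOneSpectrum (𝓞 K), MeasurableSpace (GL (Fin 2) (v.adicCompletion K) ⧸
        Subgroup.center (GL (Fin 2) (v.adicCompletion K)))]
      [∀ v : HeightOneSpectrum (𝓞 K), BorelSpace (GL (Fin 2) (v.adicCompletion K) ⧸
        Subgroup.center (GL (Fin 2) (v.adicCompletion K)))]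
      (πD : DiscreteAutomorphicRep (AdelicGroupData.units K D) μ_D), ¬ πD.IsOneDimensional →
      ∃ π : CuspidalAutomorphicRepGL 2 K μ,
        (∀ (v : HeightOneSpectrum (𝓞 K)) (hv : v ∉ ramifiedPlaces K D)
            (V : Type u) [AddCommGroup V] [Module ℂ V]
            (ρ : Representation ℂ (GL (Fin 2) (v.adicCompletion K)) V),
            ρ.IsIrreducible → ρ.IsSmooth →
              (HasLocalComponentAt π.1 v ρ ↔
                HasLocalComponentAtD (unitsEquivOfSplitting (θ₀ v hv)) πD.space ρ)) ∧
        (∀ v ∈ ramifiedPlaces K D, ∃ (V : Type) (_ : AddCommGroup V) (_ : Module ℂ V)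
            (ρ : Representation ℂ (GL (Fin 2) (v.adicCompletion K)) V),
            ρ.IsIrreducible ∧ ρ.IsAdmissible ∧ HasLocalComponentAt π.1 v ρ ∧
              ∀ (ν : Measure (GL (Fin 2) (v.adicCompletion K) ⧸
                Subgroup.center (GL (Fin 2) (v.adicCompletion K)))) [ν.IsHaarMeasure],
                ρ.IsSquareIntegrableModCenter ν)) :
    jacquetLanglands_transfer_exists K D := by
  refine jacquetLanglands_transfer_exists_of_Gelbart1975 K D ?_
    fun _ _ => nonempty_equiv_of_hasLocalComponentAt_holds
  intro hdiv μ_D _ μ _ _ _ πD hπD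
  obtain ⟨π, hloc, hsq⟩ := hA₀ hdiv μ_D μ πD hπD
  refine ⟨π, fun S φ => heckeCompatibleAway_of_localComponents πD π S φ
    fun v hv V _ _ ρ hi hs => ?_, hsq⟩
  have hv' : v ∉ ramifiedPlaces K D := fun hr => hr ⟨φ v hv⟩
  rw [hloc v hv' V ρ hi hs,
    hasLocalComponentAtD_unitsEquivOfSplitting_iff (θ₀ v hv') (φ v hv) πD.space ρ]

end Assembly

end Literature.NumberTheory.Automorphic
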